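import Summits.Parity.GeneralizedHardyLittlewood.Theorems.GreenTaoLevelTwoMNTwoBracketFrameVertical

/-!
# Route `GreenTaoLevelTwo`, crux `MNTwo` (stmt-Parity-21276), line `birth`, stub `stub_mnVertical`:
# GT 2008b App. A, Prop. 5 for VERTICAL CHARACTERS on the Heisenberg class — exact decomposition

Block V7 of the `stub_mnVertical` census (B. Green, T. Tao, *Quadratic uniformity of the Möbius
function*, Ann. Inst. Fourier 58 (2008) = arXiv:math/0606087, App. A, Prop. 5: "`F(T_gⁿ x) =
𝔼_i w_i F_i(T_{g_i}ⁿ x_i) e(−φ_i(n)) + O(ε)` … `φ_i` locally quadratic on `B_i = {n : F_i ≠ 0}`").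
For a VERTICAL CHARACTER `F = F₁ + iF₂` (`F(z·x) = e(θ(z))F(x)`, `z ∈ Z(G)`) on a nilmanifold with
a BRACKET FRAME (`…MNTwoBracketFrameHeis`; every `X^m × ℝ/ℤ`, `X ∈ 𝒞₂(H_d)`, has one by
`…MNTwoBracketFrameVertical`) the decomposition is EXACT and FINITE (no `ε`, no weights):

`F(gⁿ x) = 2 ∑_p F_p(ξ + nα) e(−φ_p(n))`, `F_p(y) = χ_p(y) F(σ_p(y)Γ)/2` `ℤ^I`-periodic,
`1`-bounded, `(K+2)(M+1)`-Lipschitz on `ℝ^I` (sup-distance), `α = π(g)`, `ξ = π(x₀)`, and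
`φ_p(n) = −θ(ζ_p(gⁿx₀))` LOCALLY QUADRATIC (integral alternating sums on `3`-cubes) on
`{n ∈ ℤ : F_p(ξ + nα) ≠ 0}` — because `e(θ(·))` is a character of the centre as soon as `F ≢ 0`
and the central parts have trivial alternating products there.  Def-free:

* `pi_zpow` — `π(g^v) = v • π(g)`;  `char_mul`, `char_one`, `char_word` — character bookkeeping;
* `vertical_decomposition` — the statement above from a bracket frame;
* `vertical_decomposition_verticalClass` — for every `X^m × ℝ/ℤ`, `X ∈ 𝒞₂(H_d)`.

References: [GreenTao2008QuadraticMobius] arXiv:math/0606087, App. A, Prop. 5.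
-/

noncomputable section

open Literature.NumberTheory.Sieve
open Literature.NumberTheory.Sieve.GreenTaoLevelTwo (HX IsCompatMetric IsBoxComparable heisenbergWith
  InHeisClass)
open scoped FourierTransform

namespace Summit.Parity.GeneralizedHardyLittlewood.GreenTaoLevelTwoMNTwoVerticalDecomposition

/-! ### §1 Horizontal coordinates of powers -/

/-- An additive coordinate map kills `1`. [folklore] -/
theorem pi_one {G I : Type} [Group G] (π : G → (I → ℝ)) (hπ : ∀ g g', π (g * g') = π g + π g') :
    π 1 = 0 := by
  have h := hπ 1 1
  rw [mul_one] at h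
  exact left_eq_add.mp h

/-- An additive coordinate map on integer powers: `π(g^v) = v • π(g)`. [folklore] -/
theorem pi_zpow {G I : Type} [Group G] (π : G → (I → ℝ)) (hπ : ∀ g g', π (g * g') = π g + π g')
    (g : G) (v : ℤ) : π (g ^ v) = (v : ℝ) • π g := by
  have hnat : ∀ n : ℕ, π (g ^ n) = (n : ℝ) • π g := by
    intro n
    induction n with
    | zero => rw [pow_zero, pi_one π hπ, Nat.cast_zero, zero_smul]
    | succ n ih => rw [pow_succ, hπ, ih, Nat.cast_succ, add_smul, one_smul]
  have hinv : ∀ a : G, π a⁻¹ = -π a := by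
    intro a
    have h := hπ a⁻¹ a
    rw [inv_mul_cancel, pi_one π hπ] at h
    exact (neg_eq_of_add_eq_zero_left h.symm).symm
  obtain ⟨n, rfl | rfl⟩ := Int.eq_nat_or_neg v
  · rw [zpow_natCast, hnat]; norm_cast
  · rw [zpow_neg, zpow_natCast, hinv, hnat, Int.cast_neg, Int.cast_natCast, neg_smul]

/-! ### §2 The vertical character is a character of the centre (mod `ℤ`) when `F ≢ 0` -/

/-- Multiplicativity mod `ℤ`: `θ(z z') ≡ θ(z) + θ(z')`. [folklore] -/
theorem char_mul {G Q : Type} [Group G] [MulAction G Q] (F : Q → ℂ) (θ : G → ℝ)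
    (hθ : ∀ z ∈ Subgroup.center G, ∀ x, F (z • x) = Complex.exp (2 * Real.pi * Complex.I * θ z) * F x)
    {x₁ : Q} (hx₁ : F x₁ ≠ 0) {z z' : G} (hz : z ∈ Subgroup.center G)
    (hz' : z' ∈ Subgroup.center G) : ∃ k : ℤ, θ (z * z') = θ z + θ z' + k := by
  have h1 := hθ (z * z') (Subgroup.mul_mem _ hz hz') x₁
  rw [mul_smul, hθ z hz, hθ z' hz', ← mul_assoc] at h1
  have h2 := mul_right_cancel₀ hx₁ h1
  rw [← Complex.exp_add] at h2
  obtain ⟨k, hk⟩ := Complex.exp_eq_exp_iff_exists_int.mp h2.symm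
  refine ⟨k, ?_⟩
  have hI : (2 * Real.pi * Complex.I : ℂ) ≠ 0 := by simp [Real.pi_ne_zero, Complex.I_ne_zero]
  have : (2 * Real.pi * Complex.I : ℂ) * (θ (z * z') : ℂ) =
      (2 * Real.pi * Complex.I) * ((θ z : ℂ) + θ z' + k) := by
    rw [hk]; ring
  have h3 := mul_left_cancel₀ hI this
  exact_mod_cast h3

/-- `θ(1) ≡ 0`. [folklore] -/
theorem char_one {G Q : Type} [Group G] [MulAction G Q] (F : Q → ℂ) (θ : G → ℝ)
    (hθ : ∀ z ∈ Subgroup.center G, ∀ x, F (z • x) = Complex.exp (2 * Real.pi * Complex.I * θ z) * F x)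
    {x₁ : Q} (hx₁ : F x₁ ≠ 0) : ∃ k : ℤ, θ 1 = k := by
  have h1 := hθ 1 (Subgroup.one_mem _) x₁
  rw [one_smul] at h1
  have h2 : Complex.exp (2 * Real.pi * Complex.I * θ 1) = 1 := by
    have := mul_right_cancel₀ hx₁ (h1.symm.trans (one_mul _).symm)
    exact this
  obtain ⟨k, hk⟩ := Complex.exp_eq_one_iff.mp h2
  refine ⟨k, ?_⟩
  have hI : (2 * Real.pi * Complex.I : ℂ) ≠ 0 := by simp [Real.pi_ne_zero, Complex.I_ne_zero]
  have : (2 * Real.pi * Complex.I : ℂ) * (θ 1 : ℂ) = (2 * Real.pi * Complex.I) * (k : ℂ) := by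
    rw [hk]; ring
  have h3 := mul_left_cancel₀ hI this
  exact_mod_cast h3

/-- `θ(z⁻¹) ≡ −θ(z)`. [folklore] -/
theorem char_inv {G Q : Type} [Group G] [MulAction G Q] (F : Q → ℂ) (θ : G → ℝ)
    (hθ : ∀ z ∈ Subgroup.center G, ∀ x, F (z • x) = Complex.exp (2 * Real.pi * Complex.I * θ z) * F x)
    {x₁ : Q} (hx₁ : F x₁ ≠ 0) {z : G} (hz : z ∈ Subgroup.center G) :
    ∃ k : ℤ, θ z⁻¹ = -θ z + k := by
  obtain ⟨k₁, hk₁⟩ := char_mul F θ hθ hx₁ (Subgroup.inv_mem _ hz) hz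
  obtain ⟨k₀, hk₀⟩ := char_one F θ hθ hx₁
  rw [inv_mul_cancel, hk₀] at hk₁
  exact ⟨k₀ - k₁, by push_cast; linarith⟩

/-- The alternating `θ`-sum over a word `a b⁻¹ c⁻¹ d⁻¹ e f g h⁻¹ = 1` of central elements is an
integer. [folklore] -/
theorem char_word {G Q : Type} [Group G] [MulAction G Q] (F : Q → ℂ) (θ : G → ℝ)
    (hθ : ∀ z ∈ Subgroup.center G, ∀ x, F (z • x) = Complex.exp (2 * Real.pi * Complex.I * θ z) * F x)
    {x₁ : Q} (hx₁ : F x₁ ≠ 0) {a b c d e f g h : G} (ha : a ∈ Subgroup.center G)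
    (hb : b ∈ Subgroup.center G) (hc : c ∈ Subgroup.center G) (hd : d ∈ Subgroup.center G)
    (he : e ∈ Subgroup.center G) (hf : f ∈ Subgroup.center G) (hg : g ∈ Subgroup.center G)
    (hh : h ∈ Subgroup.center G) (hw : a * b⁻¹ * c⁻¹ * d⁻¹ * e * f * g * h⁻¹ = 1) :
    ∃ k : ℤ, θ a - θ b - θ c - θ d + θ e + θ f + θ g - θ h = k := by
  have C := Subgroup.center G
  have m1 : a * b⁻¹ ∈ Subgroup.center G := Subgroup.mul_mem _ ha (Subgroup.inv_mem _ hb)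
  have m2 : a * b⁻¹ * c⁻¹ ∈ Subgroup.center G := Subgroup.mul_mem _ m1 (Subgroup.inv_mem _ hc)
  have m3 : a * b⁻¹ * c⁻¹ * d⁻¹ ∈ Subgroup.center G := Subgroup.mul_mem _ m2 (Subgroup.inv_mem _ hd)
  have m4 : a * b⁻¹ * c⁻¹ * d⁻¹ * e ∈ Subgroup.center G := Subgroup.mul_mem _ m3 he
  have m5 : a * b⁻¹ * c⁻¹ * d⁻¹ * e * f ∈ Subgroup.center G := Subgroup.mul_mem _ m4 hf
  have m6 : a * b⁻¹ * c⁻¹ * d⁻¹ * e * f * g ∈ Subgroup.center G := Subgroup.mul_mem _ m5 hg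
  obtain ⟨k1, e1⟩ := char_mul F θ hθ hx₁ ha (Subgroup.inv_mem _ hb)
  obtain ⟨k2, e2⟩ := char_mul F θ hθ hx₁ m1 (Subgroup.inv_mem _ hc)
  obtain ⟨k3, e3⟩ := char_mul F θ hθ hx₁ m2 (Subgroup.inv_mem _ hd)
  obtain ⟨k4, e4⟩ := char_mul F θ hθ hx₁ m3 he
  obtain ⟨k5, e5⟩ := char_mul F θ hθ hx₁ m4 hf
  obtain ⟨k6, e6⟩ := char_mul F θ hθ hx₁ m5 hg
  obtain ⟨k7, e7⟩ := char_mul F θ hθ hx₁ m6 (Subgroup.inv_mem _ hh)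
  obtain ⟨ib, eb⟩ := char_inv F θ hθ hx₁ hb
  obtain ⟨ic, ec⟩ := char_inv F θ hθ hx₁ hc
  obtain ⟨id, ed⟩ := char_inv F θ hθ hx₁ hd
  obtain ⟨ih, eh⟩ := char_inv F θ hθ hx₁ hh
  obtain ⟨k0, e0⟩ := char_one F θ hθ hx₁
  rw [hw, e0] at e7
  refine ⟨k0 - k7 - k6 - k5 - k4 - k3 - k2 - k1 - ib - ic - id - ih, ?_⟩
  push_cast
  linarith

/-! ### §3 The decomposition -/

/-- **GT 2008b Prop. 5 for vertical characters, exact form, from a bracket frame.**  See the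
module docstring. [cite: GreenTao2008QuadraticMobius, App. A, Prop. 5] -/
theorem vertical_decomposition {s : ℕ} (Y : Nilmanifold s)
    (hBF : ∃ (I : Type) (_ : Fintype I) (P : Type) (_ : Fintype P)
        (π : (Y).G → (I → ℝ)) (χ : P → (I → ℝ) → ℝ) (σ : P → (I → ℝ) → (Y).G)
        (ζ : P → (Y).G → (Y).G) (K : ℝ), 0 ≤ K ∧
        (∀ g g' : (Y).G, π (g * g') = π g + π g') ∧
        (∀ p u, 0 ≤ χ p u) ∧
        (∀ u, ∑ p, χ p u = 1) ∧
        (∀ p u (v : I → ℤ), χ p (u + fun i => (v i : ℝ)) = χ p u) ∧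
        (∀ p u u', |χ p u - χ p u'| ≤ K * dist u u') ∧
        (∀ p u (v : I → ℤ), ∃ γ ∈ (Y).Γ, σ p (u + fun i => (v i : ℝ)) = σ p u * γ) ∧
        (∀ p u u', dist u u' ≤ 1 →
          (Y).dist (σ p u : (Y).G ⧸ (Y).Γ) (σ p u' : (Y).G ⧸ (Y).Γ) ≤ K * dist u u') ∧
        (∀ p w, ζ p w ∈ Subgroup.center (Y).G) ∧
        (∀ p w, χ p (π w) ≠ 0 → ∃ γ ∈ (Y).Γ, w = ζ p w * σ p (π w) * γ) ∧
        (∀ p (g x₀ : (Y).G) (n h₁ h₂ h₃ : ℤ),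
          (∀ e₁ e₂ e₃ : ℕ, e₁ ≤ 1 → e₂ ≤ 1 → e₃ ≤ 1 →
            χ p (π (g ^ (n + e₁ * h₁ + e₂ * h₂ + e₃ * h₃) * x₀)) ≠ 0) →
          ζ p (g ^ (n + h₁ + h₂ + h₃) * x₀) * (ζ p (g ^ (n + h₁ + h₂) * x₀))⁻¹ *
            (ζ p (g ^ (n + h₁ + h₃) * x₀))⁻¹ * (ζ p (g ^ (n + h₂ + h₃) * x₀))⁻¹ *
            ζ p (g ^ (n + h₁) * x₀) * ζ p (g ^ (n + h₂) * x₀) * ζ p (g ^ (n + h₃) * x₀) *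
            (ζ p (g ^ n * x₀))⁻¹ = 1)) :
    ∃ (I : Type) (_ : Fintype I) (P : Type) (_ : Fintype P) (K : ℝ), 0 ≤ K ∧
      ∀ (M : ℝ), 0 ≤ M → ∀ (F₁ F₂ : (Y).G ⧸ (Y).Γ → ℝ),
        (Y).IsBoundedLipschitz M F₁ → (Y).IsBoundedLipschitz M F₂ →
        (∃ θ : (Y).G → ℝ, ∀ z : (Y).G, z ∈ Subgroup.center (Y).G →
          ∀ x : (Y).G ⧸ (Y).Γ, ((F₁ (z • x) : ℂ) + (F₂ (z • x) : ℂ) * Complex.I) =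
            Complex.exp (2 * Real.pi * Complex.I * θ z) * ((F₁ x : ℂ) + (F₂ x : ℂ) * Complex.I)) →
        ∀ (g : (Y).G) (x : (Y).G ⧸ (Y).Γ),
          ∃ (α xv : I → ℝ) (Fp : P → (I → ℝ) → ℂ) (φ : P → ℤ → ℝ),
            (∀ p y (v : I → ℤ), Fp p (y + fun i => (v i : ℝ)) = Fp p y) ∧
            (∀ p y, ‖Fp p y‖ ≤ 1) ∧
            (∀ p y y', ‖Fp p y - Fp p y'‖ ≤ K * (M + 1) * dist y y') ∧
            (∀ p (n h₁ h₂ h₃ : ℤ),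
              (∀ e₁ e₂ e₃ : ℕ, e₁ ≤ 1 → e₂ ≤ 1 → e₃ ≤ 1 →
                Fp p (xv + ((n + e₁ * h₁ + e₂ * h₂ + e₃ * h₃ : ℤ) : ℝ) • α) ≠ 0) →
              ∃ z : ℤ, φ p (n + h₁ + h₂ + h₃) - φ p (n + h₁ + h₂) - φ p (n + h₁ + h₃) -
                φ p (n + h₂ + h₃) + φ p (n + h₁) + φ p (n + h₂) + φ p (n + h₃) - φ p n = z) ∧
            (∀ n : ℕ, ((F₁ (g ^ n • x) : ℂ) + (F₂ (g ^ n • x) : ℂ) * Complex.I) =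
              2 * ∑ p, Fp p (xv + (n : ℝ) • α) * (𝐞 (-(φ p n)) : ℂ)) := by
  classical
  obtain ⟨I, iI, P, iP, π, χ, σ, ζ, K, hK, hπ, hχ0, hχ1, hχper, hχlip, hσper, hσlip, hζ, hbr, hcube⟩ :=
    hBF
  refine ⟨I, iI, P, iP, K + 2, by linarith, ?_⟩
  intro M hM F₁ F₂ hF₁ hF₂ hvert g x
  obtain ⟨θ, hθ⟩ := hvert
  obtain ⟨x₀, rfl⟩ := QuotientGroup.mk_surjective x
  -- the complex function, its bound and its vertical character property
  set F : Y.G ⧸ Y.Γ → ℂ := fun q => (F₁ q : ℂ) + (F₂ q : ℂ) * Complex.I with hFdef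
  have hFle : ∀ q, ‖F q‖ ≤ 2 := fun q => by
    calc ‖F q‖ ≤ ‖(F₁ q : ℂ)‖ + ‖(F₂ q : ℂ) * Complex.I‖ := norm_add_le _ _
      _ ≤ 1 + 1 := by
          rw [norm_mul, Complex.norm_I, mul_one, Complex.norm_real, Complex.norm_real,
            Real.norm_eq_abs, Real.norm_eq_abs]
          exact add_le_add (hF₁.1 q) (hF₂.1 q)
      _ = 2 := by norm_num
  have hFlip : ∀ q q', ‖F q - F q'‖ ≤ 2 * M * Y.dist q q' := fun q q' => by
    have e : F q - F q' = ((F₁ q - F₁ q' : ℝ) : ℂ) + ((F₂ q - F₂ q' : ℝ) : ℂ) * Complex.I := by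
      simp only [hFdef]; push_cast; ring
    rw [e]
    calc ‖((F₁ q - F₁ q' : ℝ) : ℂ) + ((F₂ q - F₂ q' : ℝ) : ℂ) * Complex.I‖
        ≤ ‖((F₁ q - F₁ q' : ℝ) : ℂ)‖ + ‖((F₂ q - F₂ q' : ℝ) : ℂ) * Complex.I‖ := norm_add_le _ _
      _ ≤ M * Y.dist q q' + M * Y.dist q q' := by
          rw [norm_mul, Complex.norm_I, mul_one, Complex.norm_real, Complex.norm_real,
            Real.norm_eq_abs, Real.norm_eq_abs]
          exact add_le_add (hF₁.2 q q') (hF₂.2 q q')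
      _ = 2 * M * Y.dist q q' := by ring
  have hθF : ∀ z ∈ Subgroup.center Y.G, ∀ q, F (z • q) =
      Complex.exp (2 * Real.pi * Complex.I * θ z) * F q := fun z hz q => hθ z hz q
  -- the data
  refine ⟨π g, π x₀, fun p y => (χ p y : ℂ) * F (σ p y : Y.G ⧸ Y.Γ) / 2,
    fun p n => -θ (ζ p (g ^ n * x₀)), fun p y v => ?_, fun p y => ?_, fun p y y' => ?_,
    fun p n h₁ h₂ h₃ hsupp => ?_, fun n => ?_⟩
  · -- periodicity
    obtain ⟨γ, hγ, hσ⟩ := hσper p y v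
    simp only [hχper, hσ, QuotientGroup.mk_mul_of_mem _ hγ]
  · -- `1`-boundedness
    rw [norm_div, norm_mul, Complex.norm_real, Real.norm_eq_abs,
      abs_of_nonneg (hχ0 p y), Complex.norm_two]
    have h1 := GreenTaoLevelTwoMNTwoBracketFrameVertical.le_one_of_sum_eq_one (fun q => hχ0 q y)
      (hχ1 y) p
    have h2 := hFle (σ p y : Y.G ⧸ Y.Γ)
    have : χ p y * ‖F (σ p y : Y.G ⧸ Y.Γ)‖ ≤ 1 * 2 :=
      mul_le_mul h1 h2 (norm_nonneg _) zero_le_one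
    linarith
  · -- Lipschitz bound
    have hd : 0 ≤ dist y y' := dist_nonneg
    by_cases hyy : dist y y' ≤ 1
    · have e : (χ p y : ℂ) * F (σ p y : Y.G ⧸ Y.Γ) / 2 - (χ p y' : ℂ) * F (σ p y' : Y.G ⧸ Y.Γ) / 2 =
          (((χ p y - χ p y' : ℝ) : ℂ) * F (σ p y : Y.G ⧸ Y.Γ) +
            (χ p y' : ℂ) * (F (σ p y : Y.G ⧸ Y.Γ) - F (σ p y' : Y.G ⧸ Y.Γ))) / 2 := by
        push_cast; ring
      rw [e, norm_div, Complex.norm_two]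
      have h1 : ‖((χ p y - χ p y' : ℝ) : ℂ) * F (σ p y : Y.G ⧸ Y.Γ)‖ ≤ K * dist y y' * 2 := by
        rw [norm_mul, Complex.norm_real, Real.norm_eq_abs]
        exact mul_le_mul (hχlip p y y') (hFle _) (norm_nonneg _) (by positivity)
      have hχ1' := GreenTaoLevelTwoMNTwoBracketFrameVertical.le_one_of_sum_eq_one
        (fun q => hχ0 q y') (hχ1 y') p
      have h2 : ‖(χ p y' : ℂ) * (F (σ p y : Y.G ⧸ Y.Γ) - F (σ p y' : Y.G ⧸ Y.Γ))‖ ≤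
          1 * (2 * M * (K * dist y y')) := by
        rw [norm_mul, Complex.norm_real, Real.norm_eq_abs, abs_of_nonneg (hχ0 p y')]
        refine mul_le_mul hχ1' ((hFlip _ _).trans ?_) (norm_nonneg _) zero_le_one
        exact mul_le_mul_of_nonneg_left (hσlip p y y' hyy) (by positivity)
      calc ‖((χ p y - χ p y' : ℝ) : ℂ) * F (σ p y : Y.G ⧸ Y.Γ) +
            (χ p y' : ℂ) * (F (σ p y : Y.G ⧸ Y.Γ) - F (σ p y' : Y.G ⧸ Y.Γ))‖ / 2
          ≤ (K * dist y y' * 2 + 1 * (2 * M * (K * dist y y'))) / 2 := by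
            gcongr
            exact (norm_add_le _ _).trans (add_le_add h1 h2)
        _ = K * (M + 1) * dist y y' := by ring
        _ ≤ (K + 2) * (M + 1) * dist y y' := by gcongr; linarith
    · push Not at hyy
      have hb1 : ‖(χ p y : ℂ) * F (σ p y : Y.G ⧸ Y.Γ) / 2‖ ≤ 1 := by
        rw [norm_div, norm_mul, Complex.norm_real, Real.norm_eq_abs, abs_of_nonneg (hχ0 p y),
          Complex.norm_two]
        have := mul_le_mul (GreenTaoLevelTwoMNTwoBracketFrameVertical.le_one_of_sum_eq_one
          (fun q => hχ0 q y) (hχ1 y) p) (hFle (σ p y : Y.G ⧸ Y.Γ)) (norm_nonneg _) zero_le_one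
        linarith
      have hb2 : ‖(χ p y' : ℂ) * F (σ p y' : Y.G ⧸ Y.Γ) / 2‖ ≤ 1 := by
        rw [norm_div, norm_mul, Complex.norm_real, Real.norm_eq_abs, abs_of_nonneg (hχ0 p y'),
          Complex.norm_two]
        have := mul_le_mul (GreenTaoLevelTwoMNTwoBracketFrameVertical.le_one_of_sum_eq_one
          (fun q => hχ0 q y') (hχ1 y') p) (hFle (σ p y' : Y.G ⧸ Y.Γ)) (norm_nonneg _) zero_le_one
        linarith
      have h2 : (2 : ℝ) ≤ (K + 2) * (M + 1) := by nlinarith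
      have h3 : (K + 2) * (M + 1) * 1 ≤ (K + 2) * (M + 1) * dist y y' :=
        mul_le_mul_of_nonneg_left hyy.le (by positivity)
      calc ‖(χ p y : ℂ) * F (σ p y : Y.G ⧸ Y.Γ) / 2 - (χ p y' : ℂ) * F (σ p y' : Y.G ⧸ Y.Γ) / 2‖
          ≤ 1 + 1 := (norm_sub_le _ _).trans (add_le_add hb1 hb2)
        _ ≤ (K + 2) * (M + 1) * dist y y' := by linarith
  · -- local quadraticity of the phase on the support
    beta_reduce at hsupp
    have hvert : ∀ v : ℤ, π x₀ + ((v : ℤ) : ℝ) • π g = π (g ^ v * x₀) := fun v => by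
      rw [hπ, pi_zpow π hπ, add_comm]
    have hsupp' : ∀ e₁ e₂ e₃ : ℕ, e₁ ≤ 1 → e₂ ≤ 1 → e₃ ≤ 1 →
        χ p (π (g ^ (n + e₁ * h₁ + e₂ * h₂ + e₃ * h₃) * x₀)) ≠ 0 := by
      intro e₁ e₂ e₃ a b c hzero
      apply hsupp e₁ e₂ e₃ a b c
      rw [hvert, hzero]; simp
    -- a point where `F ≠ 0`
    have hx₁ : F (σ p (π (g ^ n * x₀)) : Y.G ⧸ Y.Γ) ≠ 0 := by
      intro hzero
      have h0 := hsupp 0 0 0 (by norm_num) (by norm_num) (by norm_num)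
      simp only [Nat.cast_zero, zero_mul, add_zero] at h0
      apply h0
      rw [hvert, hzero]; simp
    have key := hcube p g x₀ n h₁ h₂ h₃ hsupp'
    obtain ⟨k, hk⟩ := char_word F θ hθF hx₁ (hζ p _) (hζ p _) (hζ p _) (hζ p _) (hζ p _) (hζ p _)
      (hζ p _) (hζ p _) key
    exact ⟨-k, by rw [Int.cast_neg, ← hk]; ring⟩
  · -- the identity `F(gⁿx) = 2 ∑_p F_p(ξ + nα) e(−φ_p(n))`
    have hw : π x₀ + (n : ℝ) • π g = π (g ^ n * x₀) := by
      rw [hπ, ← zpow_natCast, pi_zpow π hπ, Int.cast_natCast, add_comm]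
    have hsm : g ^ n • (x₀ : Y.G ⧸ Y.Γ) = ((g ^ n * x₀ : Y.G) : Y.G ⧸ Y.Γ) := by
      rw [MulAction.Quotient.smul_mk, smul_eq_mul]
    beta_reduce
    simp only [zpow_natCast, hsm, hw]
    set w := g ^ n * x₀ with hwdef
    have hterm : ∀ p, (χ p (π w) : ℂ) * F (σ p (π w) : Y.G ⧸ Y.Γ) / 2 * (𝐞 (-(-θ (ζ p w))) : ℂ) =
        (χ p (π w) : ℂ) * F (w : Y.G ⧸ Y.Γ) / 2 := by
      intro p
      by_cases hp : χ p (π w) = 0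
      · simp [hp]
      · obtain ⟨γ, hγ, hwd⟩ := hbr p w hp
        have hq : (w : Y.G ⧸ Y.Γ) = ζ p w • (σ p (π w) : Y.G ⧸ Y.Γ) := by
          conv_lhs => rw [hwd]
          rw [QuotientGroup.mk_mul_of_mem _ hγ, MulAction.Quotient.smul_mk, smul_eq_mul]
        have hF : F (w : Y.G ⧸ Y.Γ) =
            Complex.exp (2 * Real.pi * Complex.I * θ (ζ p w)) * F (σ p (π w) : Y.G ⧸ Y.Γ) := by
          rw [hq]; exact hθF _ (hζ p w) _
        have he : (𝐞 (-(-θ (ζ p w))) : ℂ) = Complex.exp (2 * Real.pi * Complex.I * θ (ζ p w)) := by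
          simp only [neg_neg]
          refine (Real.fourierChar_apply _).trans ?_
          congr 1; push_cast; ring
        rw [hF, he]; ring
    simp only [hterm]
    change F (w : Y.G ⧸ Y.Γ) = _
    rw [Finset.mul_sum]
    have hsum : ∑ p, 2 * ((χ p (π w) : ℂ) * F (w : Y.G ⧸ Y.Γ) / 2) =
        (∑ p, (χ p (π w) : ℂ)) * F (w : Y.G ⧸ Y.Γ) := by
      rw [Finset.sum_mul]
      exact Finset.sum_congr rfl fun p _ => by ring
    rw [hsum]
    have h1 : ∑ p, (χ p (π w) : ℂ) = 1 := by exact_mod_cast hχ1 (π w)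
    rw [h1, one_mul]

/-- **GT 2008b Prop. 5 (vertical characters, exact) on the vertical class**: every
`X^m × ℝ/ℤ`, `X ∈ 𝒞₂(H_d)` (`d` box-comparable), admits the decomposition of
`vertical_decomposition`. [cite: GreenTao2008QuadraticMobius, App. A, Prop. 5] -/
theorem vertical_decomposition_verticalClass (d : HX → HX → ℝ) (h : IsCompatMetric d)
    (hd : IsBoxComparable d) (X : Nilmanifold 2) (hX : InHeisClass (heisenbergWith d h) X) (m : ℕ) :
    ∃ (I : Type) (_ : Fintype I) (P : Type) (_ : Fintype P) (K : ℝ), 0 ≤ K ∧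
      ∀ (M : ℝ), 0 ≤ M → ∀ (F₁ F₂ : ((X.pow m).prod (Nilmanifold.circle.ofLE one_le_two)).G ⧸ ((X.pow m).prod (Nilmanifold.circle.ofLE one_le_two)).Γ → ℝ),
        ((X.pow m).prod (Nilmanifold.circle.ofLE one_le_two)).IsBoundedLipschitz M F₁ → ((X.pow m).prod (Nilmanifold.circle.ofLE one_le_two)).IsBoundedLipschitz M F₂ →
        (∃ θ : ((X.pow m).prod (Nilmanifold.circle.ofLE one_le_two)).G → ℝ, ∀ z : ((X.pow m).prod (Nilmanifold.circle.ofLE one_le_two)).G, z ∈ Subgroup.center ((X.pow m).prod (Nilmanifold.circle.ofLE one_le_two)).G →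
          ∀ x : ((X.pow m).prod (Nilmanifold.circle.ofLE one_le_two)).G ⧸ ((X.pow m).prod (Nilmanifold.circle.ofLE one_le_two)).Γ, ((F₁ (z • x) : ℂ) + (F₂ (z • x) : ℂ) * Complex.I) =
            Complex.exp (2 * Real.pi * Complex.I * θ z) * ((F₁ x : ℂ) + (F₂ x : ℂ) * Complex.I)) →
        ∀ (g : ((X.pow m).prod (Nilmanifold.circle.ofLE one_le_two)).G) (x : ((X.pow m).prod (Nilmanifold.circle.ofLE one_le_two)).G ⧸ ((X.pow m).prod (Nilmanifold.circle.ofLE one_le_two)).Γ),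
          ∃ (α xv : I → ℝ) (Fp : P → (I → ℝ) → ℂ) (φ : P → ℤ → ℝ),
            (∀ p y (v : I → ℤ), Fp p (y + fun i => (v i : ℝ)) = Fp p y) ∧
            (∀ p y, ‖Fp p y‖ ≤ 1) ∧
            (∀ p y y', ‖Fp p y - Fp p y'‖ ≤ K * (M + 1) * dist y y') ∧
            (∀ p (n h₁ h₂ h₃ : ℤ),
              (∀ e₁ e₂ e₃ : ℕ, e₁ ≤ 1 → e₂ ≤ 1 → e₃ ≤ 1 →
                Fp p (xv + ((n + e₁ * h₁ + e₂ * h₂ + e₃ * h₃ : ℤ) : ℝ) • α) ≠ 0) →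
              ∃ z : ℤ, φ p (n + h₁ + h₂ + h₃) - φ p (n + h₁ + h₂) - φ p (n + h₁ + h₃) -
                φ p (n + h₂ + h₃) + φ p (n + h₁) + φ p (n + h₂) + φ p (n + h₃) - φ p n = z) ∧
            (∀ n : ℕ, ((F₁ (g ^ n • x) : ℂ) + (F₂ (g ^ n • x) : ℂ) * Complex.I) =
              2 * ∑ p, Fp p (xv + (n : ℝ) • α) * (𝐞 (-(φ p n)) : ℂ)) :=
  vertical_decomposition _
    (GreenTaoLevelTwoMNTwoBracketFrameVertical.bracketFrame_verticalClass d h hd X hX m)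

end Summit.Parity.GeneralizedHardyLittlewood.GreenTaoLevelTwoMNTwoVerticalDecomposition
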